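import Literature.NumberTheory.NumberFields.AdjoinSqrtNegOneRamificationAtTwo
import Mathlib.NumberTheory.NumberField.Discriminant.Different
import HarnessLib

/-!
# A prime `𝔭₁` of norm `2` with `2 ∉ 𝔭₁²` in a quadratic extension `L = K(√2)`: `e = 2`, `f = 1`, `2 + √2 ∈ P ∖ P²`, and the
# BASE-FIELD CERTIFICATE `d(A − 1) = π₁²γ₀`, `dB = π₁²γ₁` ⟹ `A + B√2 − 1 ∈ P⁴ ∖ P⁵`

Topic `NumberTheory/NumberFields` (namespace = path).  THEOREMS ONLY (no definition, no named fact, no instance, no `sorry`); unconditional.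
Written by the prover seat `bsd-line-att-p3` g41 (cell `bsd-f1-sign2`, route `AlignedTransportAtTwo`, crux C2 stmt-BirchSwinnertonDyer-22298;
`--supports`, closes nothing).  Sequel of `AdjoinSqrtNegOneRamificationAtTwo.lean` (bsd-2adic: the same bookkeeping for `L = K(√−1)`) and the
arithmetic half of `IwasawaTheory/ClassicalMuVanishesLayerOneUnitCertificateTwo.lean` (the layer-one unit door): the hypotheses
`2 ∈ P² ∖ P³`, `m ∈ P ∖ P²`, `v − 1 ∈ P⁴ ∖ P⁵` of the tree's dyadic non-norm lemma at `e = 2`, `f = 1`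
(`QuadraticNonNormUnitDyadicIdeal.unitsIncl_unitsMap_not_mem_map_norm_of_sub_one_mem_pow_four`, O'Meara 63:10) are DERIVED for the prime `P` of
`L = K(s)`, `s² = 2`, above a degree-one unramified dyadic prime `𝔭₁` of `K`, from data in `𝓞_K` alone.

* `isPrime_and_mem_of_absNorm_eq_two` (`N𝔭₁ = 2` ⟹ prime, `∋ 2`, `#(𝓞_K/𝔭₁) = 2`); `ramificationIdx_int_eq_one_of_two_not_mem_sq` (`e(𝔭₁|2ℤ) = 1`);
  `two_not_mem_sq_of_not_dvd_discr` (`2 ∤ d_K` ⟹ `2 ∉ 𝔭²` for every `𝔭 ∋ 2`, Mathlib `NumberField.not_dvd_discr_iff_isUnramifiedIn`).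
* ★ `ramificationIdx_eq_two_of_sq_eq_two` — `[L:K] = 2` Galois, `s² = 2` in `L`, `𝔭₁ ∋ 2` with `2 ∉ 𝔭₁²`, `P ∣ 𝔭₁`: `e(P|𝔭₁) = 2`, ONE prime above `𝔭₁`,
  `f(P|𝔭₁) = 1` (`e(P|2ℤ) = e(𝔭₁|2ℤ)·e(P|𝔭₁)` is even since `2𝓞_L = (s)²`; fundamental identity `g·e·f = 2`); `card_quotient_eq_two_of_sq_eq_two`
  (`𝓞_L/P = 𝔽₂` by `N(P) = N(𝔭₁)^f`).
* `two_mem_sq_and_two_add_mem_of_sq_eq_two` (`2 ∈ P² ∖ P³`, `2 + s ∈ P ∖ P²`); `algebraMap_mem_sq_of_mem_of_not_mem_sq` (`π₁ ∈ 𝔭₁ ∖ 𝔭₁²` ⟹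
  `π₁ ∈ P² ∖ P³`: `𝔭₁𝓞_L ≤ P²` and `𝔭₁ = (π₁) + 𝔭₁²`).
* ★★ `sub_one_mem_pow_four_of_baseCert` — `A, B, π₁, d, γ₀, γ₁ ∈ 𝓞_K`, `π₁ ∈ 𝔭₁ ∖ 𝔭₁²`, `d, γ₀ ∉ 𝔭₁`, `d(A − 1) = π₁²γ₀`, `dB = π₁²γ₁` ⟹
  `v = A + Bs` has `v − 1 ∈ P⁴ ∖ P⁵` (`d(v − 1) = π₁²(γ₀ + γ₁s)`, `v_P(d) = v_P(γ₀ + γ₁s) = 0`, `v_P(π₁) = 2`; multiplicities of `P` in principal ideals).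
  All conditions are identities or ideal memberships in `𝓞_K` and do not see the sign of `s`.

HONEST SCOPE: elementary Dedekind bookkeeping (Neukirch I §8); nothing specific to any summit; BSD is not advanced by this file.

## References

* J. Neukirch, *Algebraic Number Theory* (1999), Ch. I §8 Prop. (8.2) (fundamental identity; `N𝔭 = p^f`), Ch. III (2.12) (`p ∣ d_K` iff `p` ramifies).
  [NeukirchANT1999]
* O. T. O'Meara, *Introduction to Quadratic Forms* (1963), §63A (63:1), §63B (63:10) (the local statement these hypotheses feed). [Omeara1963]
* L. C. Washington, *Introduction to Cyclotomic Fields*, 2nd ed. (1997), §13.1 Prop. 13.2 (`ℚ_1 = ℚ(√2)`; the layer `K(√2)`). [Washington1997]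
-/

noncomputable section

open NumberField IsDedekindDomain Field UniqueFactorizationMonoid
open scoped nonZeroDivisors

namespace Literature.NumberTheory.NumberFields

/-! ## §0 Valuation bookkeeping at a prime of a Dedekind domain (count of `P` in a factorisation) -/

section Count

variable {R : Type*} [CommRing R] [IsDedekindDomain R]

/-- `I ≤ P^k` iff `k ≤` the multiplicity of `P` in `I` (Dedekind domain, `I ≠ 0`, `P ≠ 0` prime). [folklore] -/
private theorem le_pow_iff_le_count {P I : Ideal R} [hP : P.IsPrime] (hP0 : P ≠ ⊥) (hI : I ≠ ⊥) (k : ℕ) :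
    I ≤ P ^ k ↔ k ≤ (normalizedFactors I).count P := by
  classical
  rw [← Ideal.dvd_iff_le, pow_dvd_iff_le_emultiplicity,
    emultiplicity_eq_count_normalizedFactors (Ideal.prime_of_isPrime hP0 hP).irreducible hI, normalize_eq,
    Nat.cast_le]

/-- `x ∈ P^k` iff `k ≤` the multiplicity of `P` in `(x)` (`x ≠ 0`). [folklore] -/
private theorem mem_pow_iff_le_count {P : Ideal R} [hP : P.IsPrime] (hP0 : P ≠ ⊥) {x : R} (hx : x ≠ 0) (k : ℕ) :
    x ∈ P ^ k ↔ k ≤ (normalizedFactors (Ideal.span {x})).count P := by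
  rw [← Ideal.span_singleton_le_iff_mem]
  exact le_pow_iff_le_count hP0 (by rwa [Ne, Ideal.span_singleton_eq_bot]) k

/-- The multiplicity of `P` in `(xy)` is the sum of the multiplicities (`x, y ≠ 0`). [folklore] -/
private theorem count_span_mul {P : Ideal R} {x y : R} (hx : x ≠ 0) (hy : y ≠ 0) :
    (normalizedFactors (Ideal.span {x * y})).count P =
      (normalizedFactors (Ideal.span {x})).count P + (normalizedFactors (Ideal.span {y})).count P := by
  classical
  rw [← Ideal.span_singleton_mul_span_singleton,
    normalizedFactors_mul (by rw [Ne, Ideal.zero_eq_bot, Ideal.span_singleton_eq_bot]; exact hx)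
      (by rw [Ne, Ideal.zero_eq_bot, Ideal.span_singleton_eq_bot]; exact hy),
    Multiset.count_add]

/-- The multiplicity of `P` in `(x)` is `n` when `x ∈ P^n ∖ P^(n+1)`. [folklore] -/
private theorem count_span_eq_of_mem_of_not_mem {P : Ideal R} [hP : P.IsPrime] {x : R} {n : ℕ} (hle : x ∈ P ^ n)
    (hlt : x ∉ P ^ (n + 1)) : (normalizedFactors (Ideal.span {x})).count P = n :=
  Ideal.count_normalizedFactors_eq (by rwa [Ideal.span_singleton_le_iff_mem]) (by rwa [Ideal.span_singleton_le_iff_mem])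

end Count

/-! ## §1 A degree-one unramified dyadic prime `𝔭₁` of `K` in a quadratic extension `L = K(√2)` -/

section Quadratic

variable {K L : Type} [Field K] [NumberField K] [Field L] [NumberField L] [Algebra K L]

/-- **A prime of norm `2`.**  An ideal `𝔭₁` of `𝓞 K` with `N𝔭₁ = 2` is a non-zero prime (indeed maximal) ideal containing `2`, lying over
`2ℤ`, with residue ring of cardinality `2`. [cite: NeukirchANT1999, Ch. I §8 (the norm of a prime ideal is `p^f`)] -/
theorem isPrime_and_mem_of_absNorm_eq_two (𝔭₁ : Ideal (𝓞 K)) (hN : Ideal.absNorm 𝔭₁ = 2) :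
    𝔭₁.IsPrime ∧ 𝔭₁ ≠ ⊥ ∧ (2 : 𝓞 K) ∈ 𝔭₁ ∧ Nat.card (𝓞 K ⧸ 𝔭₁) = 2 := by
  have hprime : 𝔭₁.IsPrime :=
    Ideal.isPrime_of_irreducible_absNorm (by rw [hN]; exact Nat.prime_two.prime.irreducible)
  refine ⟨hprime, fun h => ?_, ?_, ?_⟩
  · rw [h, Ideal.absNorm_bot] at hN; exact absurd hN (by norm_num)
  · have h := Ideal.absNorm_mem 𝔭₁
    rw [hN, Nat.cast_ofNat] at h
    exact h
  · rw [← Submodule.cardQuot_apply, ← Ideal.absNorm_apply, hN]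

omit [NumberField K] in
/-- A prime of `𝓞 K` containing `2` lies over `2ℤ`. [folklore] -/
private theorem liesOver_span_two {p : Ideal (𝓞 K)} [p.IsPrime] (h2 : (2 : 𝓞 K) ∈ p) :
    p.LiesOver (Ideal.span {(2 : ℤ)}) := by
  refine ⟨?_⟩
  have hmax : (Ideal.span {(2 : ℤ)}).IsMaximal :=
    PrincipalIdealRing.isMaximal_of_irreducible (Int.prime_two.irreducible)
  have hle : Ideal.span {(2 : ℤ)} ≤ p.under ℤ := by
    rw [Ideal.span_le, Set.singleton_subset_iff]
    change algebraMap ℤ (𝓞 K) 2 ∈ p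
    rwa [map_ofNat]
  exact (hmax.eq_of_le (Ideal.IsPrime.ne_top inferInstance) hle)

/-- **`e(𝔭₁ | 2ℤ) = 1` for a prime `𝔭₁ ∋ 2` with `2 ∉ 𝔭₁²`** (the multiplicity of `𝔭₁` in `2𝓞_K` is `1`).
[cite: NeukirchANT1999, Ch. I §8 (8.2)] -/
theorem ramificationIdx_int_eq_one_of_two_not_mem_sq (𝔭₁ : Ideal (𝓞 K)) [𝔭₁.IsPrime] (h2 : (2 : 𝓞 K) ∈ 𝔭₁)
    (hunr : (2 : 𝓞 K) ∉ 𝔭₁ ^ 2) : 𝔭₁.ramificationIdx ℤ = 1 := by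
  classical
  haveI := liesOver_span_two h2
  have hmap : Ideal.map (algebraMap ℤ (𝓞 K)) (Ideal.span {(2 : ℤ)}) = Ideal.span {(2 : 𝓞 K)} := by
    rw [Ideal.map_span, Set.image_singleton, map_ofNat]
  have hp0 : Ideal.map (algebraMap ℤ (𝓞 K)) (Ideal.span {(2 : ℤ)}) ≠ ⊥ :=
    Ideal.map_ne_bot_of_ne_bot (by simp)
  rw [Ideal.IsDedekindDomain.ramificationIdx_eq_normalizedFactors_count (Ideal.span {(2 : ℤ)}) 𝔭₁ hp0, hmap]
  exact Ideal.count_normalizedFactors_eq (by rwa [pow_one, Ideal.span_singleton_le_iff_mem])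
    (by rwa [Ideal.span_singleton_le_iff_mem])

/-- **`2 ∤ d_K` ⟹ every dyadic prime of `K` is unramified**: `2 ∉ 𝔭²` for every prime `𝔭 ∋ 2` of `𝓞_K` (Mathlib
`NumberField.not_dvd_discr_iff_isUnramifiedIn`: `e(𝔭 | 2ℤ) = 1`, and `e` is the multiplicity of `𝔭` in `2𝓞_K`).
[cite: NeukirchANT1999, Ch. III (2.12)] -/
theorem two_not_mem_sq_of_not_dvd_discr (hd : ¬ (2 : ℤ) ∣ NumberField.discr K) (𝔭 : Ideal (𝓞 K)) [𝔭.IsPrime]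
    (h2 : (2 : 𝓞 K) ∈ 𝔭) : (2 : 𝓞 K) ∉ 𝔭 ^ 2 := by
  classical
  haveI := liesOver_span_two h2
  have h𝔭0 : 𝔭 ≠ ⊥ := Ideal.ne_bot_of_liesOver_of_ne_bot (by simp : Ideal.span {(2 : ℤ)} ≠ ⊥) 𝔭
  have hunr : Algebra.IsUnramifiedIn (𝓞 K) (Ideal.span {(2 : ℤ)}) :=
    (NumberField.not_dvd_discr_iff_isUnramifiedIn K (𝓞 K) Int.prime_two).mp hd
  have he : 𝔭.ramificationIdx ℤ = 1 := hunr.ramificationIdx_eq_one (𝔓 := 𝔭) inferInstance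
  have hmap : Ideal.map (algebraMap ℤ (𝓞 K)) (Ideal.span {(2 : ℤ)}) = Ideal.span {(2 : 𝓞 K)} := by
    rw [Ideal.map_span, Set.image_singleton, map_ofNat]
  have hp0 : Ideal.map (algebraMap ℤ (𝓞 K)) (Ideal.span {(2 : ℤ)}) ≠ ⊥ := Ideal.map_ne_bot_of_ne_bot (by simp)
  rw [Ideal.IsDedekindDomain.ramificationIdx_eq_normalizedFactors_count (Ideal.span {(2 : ℤ)}) 𝔭 hp0, hmap] at he
  intro h
  have := (mem_pow_iff_le_count h𝔭0 two_ne_zero 2).mp h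
  rw [he] at this
  omega

/-- `e(Q | 2ℤ)` is even for every prime `Q` of `𝓞_L` above `2` when `s² = 2` in `L` (`2𝓞_L = (s)²`; the tree's
`IwasawaTheory.even_ramificationIdx_int_of_sq_eq_two`, re-proved here to keep this file inside `NumberFields`). [folklore]
[cite: NeukirchANT1999, Ch. I §8 (prime factorisation of `p𝓞_L`)] -/
private theorem even_ramificationIdx_int_of_sq_eq_two' {s : L} (hs : s ^ 2 = 2) (Q : Ideal (𝓞 L)) [Q.IsPrime]
    [Q.LiesOver (Ideal.span {(2 : ℤ)})] : Even (Q.ramificationIdx ℤ) := by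
  classical
  have hsint : IsIntegral ℤ s := by
    refine ⟨Polynomial.X ^ 2 - Polynomial.C 2, Polynomial.monic_X_pow_sub_C _ two_ne_zero, ?_⟩
    simp [hs]
  set s' : 𝓞 L := ⟨s, hsint⟩ with hs'
  have hs'2 : s' ^ 2 = 2 := by
    apply Subtype.ext
    change ((s' ^ 2 : 𝓞 L) : L) = ((2 : 𝓞 L) : L)
    push_cast
    exact hs
  have hmap : Ideal.map (algebraMap ℤ (𝓞 L)) (Ideal.span {(2 : ℤ)}) = Ideal.span {s'} ^ 2 := by
    rw [Ideal.map_span, Set.image_singleton, map_ofNat, Ideal.span_singleton_pow, hs'2]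
  have hp0 : Ideal.map (algebraMap ℤ (𝓞 L)) (Ideal.span {(2 : ℤ)}) ≠ ⊥ := Ideal.map_ne_bot_of_ne_bot (by simp)
  rw [Ideal.IsDedekindDomain.ramificationIdx_eq_normalizedFactors_count (Ideal.span {(2 : ℤ)}) Q hp0, hmap,
    normalizedFactors_pow, Multiset.count_nsmul]
  exact even_two_mul _

variable [IsGalois K L]

/-- **`e(P | 𝔭₁) = 2`, ONE prime above `𝔭₁`, `f(P | 𝔭₁) = 1`** for `L ∋ s` with `s² = 2`, `[L : K] = 2` Galois, and a prime `𝔭₁ ∋ 2` of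
`K` with `2 ∉ 𝔭₁²`: `e(P | 2ℤ) = e(𝔭₁ | 2ℤ)·e(P | 𝔭₁)` is even (`2𝓞_L = (s)²`) while `e(𝔭₁ | 2ℤ) = 1`, so `e(P | 𝔭₁)` is even and divides
`[L : K] = 2` (fundamental identity `g·e·f = 2`). [cite: NeukirchANT1999, Ch. I §8 Prop. (8.2)] [cite: Washington1997, §13.1 Prop. 13.2] -/
theorem ramificationIdx_eq_two_of_sq_eq_two (h2 : Module.finrank K L = 2) {s : L} (hs : s ^ 2 = 2)
    (𝔭₁ : Ideal (𝓞 K)) [𝔭₁.IsPrime] (h2𝔭 : (2 : 𝓞 K) ∈ 𝔭₁) (hunr : (2 : 𝓞 K) ∉ 𝔭₁ ^ 2)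
    (P : Ideal (𝓞 L)) [P.IsPrime] [P.LiesOver 𝔭₁] :
    P.ramificationIdx (𝓞 K) = 2 ∧ (𝔭₁.primesOver (𝓞 L)).ncard = 1 ∧ 𝔭₁.inertiaDegIn (𝓞 L) = 1 := by
  classical
  haveI := liesOver_span_two h2𝔭
  haveI : P.LiesOver (Ideal.span {(2 : ℤ)}) := Ideal.LiesOver.trans P 𝔭₁ _
  have hP2 : P.under (𝓞 K) = 𝔭₁ := (Ideal.over_def P 𝔭₁).symm
  have htower : P.ramificationIdx ℤ = 𝔭₁.ramificationIdx ℤ * P.ramificationIdx (𝓞 K) := by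
    have h := Ideal.ramificationIdx_tower (P.under (𝓞 K)) P (R := ℤ)
    rwa [hP2] at h
  have heven := even_ramificationIdx_int_of_sq_eq_two' hs P
  rw [htower, ramificationIdx_int_eq_one_of_two_not_mem_sq 𝔭₁ h2𝔭 hunr, one_mul] at heven
  -- the fundamental identity `g · (e · f) = 2`
  have hfund := Ideal.ncard_primesOver_mul_ramificationIdxIn_mul_inertiaDegIn 𝔭₁ (𝓞 L) (L ≃ₐ[K] L)
  rw [IsGalois.card_aut_eq_finrank, h2, Ideal.ramificationIdxIn_eq_ramificationIdx 𝔭₁ P (L ≃ₐ[K] L)] at hfund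
  have hedvd : P.ramificationIdx (𝓞 K) ∣ 2 :=
    ⟨(𝔭₁.primesOver (𝓞 L)).ncard * 𝔭₁.inertiaDegIn (𝓞 L), by rw [← hfund]; ring⟩
  have he2 : P.ramificationIdx (𝓞 K) = 2 := by
    rcases (Nat.dvd_prime Nat.prime_two).mp hedvd with h | h
    · rw [h] at heven; exact absurd heven (by decide)
    · exact h
  rw [he2] at hfund
  have hgf : (𝔭₁.primesOver (𝓞 L)).ncard * 𝔭₁.inertiaDegIn (𝓞 L) = 1 := by linarith
  exact ⟨he2, Nat.eq_one_of_mul_eq_one_right hgf, Nat.eq_one_of_mul_eq_one_left hgf⟩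

/-- **The residue field of `P` is `𝔽₂`** (`#(𝓞_L/P) = 2`): `N(P) = N(𝔭₁)^{f(P|𝔭₁)} = 2`. [cite: NeukirchANT1999, Ch. I §8 (8.2)] -/
theorem card_quotient_eq_two_of_sq_eq_two (h2 : Module.finrank K L = 2) {s : L} (hs : s ^ 2 = 2)
    (𝔭₁ : Ideal (𝓞 K)) (hN : Ideal.absNorm 𝔭₁ = 2) (hunr : (2 : 𝓞 K) ∉ 𝔭₁ ^ 2)
    (P : Ideal (𝓞 L)) [P.IsMaximal] [P.LiesOver 𝔭₁] : Nat.card (𝓞 L ⧸ P) = 2 := by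
  obtain ⟨h𝔭, h𝔭0, h2𝔭, -⟩ := isPrime_and_mem_of_absNorm_eq_two 𝔭₁ hN
  haveI := h𝔭
  haveI : 𝔭₁.IsMaximal := h𝔭.isMaximal h𝔭0
  obtain ⟨-, -, hf⟩ := ramificationIdx_eq_two_of_sq_eq_two h2 hs 𝔭₁ h2𝔭 hunr P
  rw [Ideal.inertiaDegIn_eq_inertiaDeg 𝔭₁ P (L ≃ₐ[K] L)] at hf
  have h := Ideal.absNorm_eq_pow_inertiaDeg'_of_liesOver P 𝔭₁ h𝔭 h𝔭0
  rw [Ideal.inertiaDeg'_eq_inertiaDeg 𝔭₁ P, hf, hN, pow_one] at h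
  rw [← Submodule.cardQuot_apply, ← Ideal.absNorm_apply, h]


/-- **Valuations at `P`: `v_P(2) = 2`, `v_P(2 + s) = 1`** (`s ∈ 𝓞_L`, `s² = 2`): `2 ∈ P² ∖ P³` and `2 + s ∈ P ∖ P²` — the hypotheses
`e = 2`, `𝔭 ‖ m` (with `m = 2 + s`) of the dyadic non-norm lemma at `e = 2`, `f = 1`. [cite: NeukirchANT1999, Ch. I §8 Prop. (8.2)]
[cite: Omeara1963, §63A (63:1)] -/
theorem two_mem_sq_and_two_add_mem_of_sq_eq_two (h2 : Module.finrank K L = 2) {s : 𝓞 L} (hs : s ^ 2 = 2)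
    (𝔭₁ : Ideal (𝓞 K)) [𝔭₁.IsPrime] (h2𝔭 : (2 : 𝓞 K) ∈ 𝔭₁) (hunr : (2 : 𝓞 K) ∉ 𝔭₁ ^ 2)
    (P : Ideal (𝓞 L)) [P.IsPrime] [P.LiesOver 𝔭₁] :
    ((2 : 𝓞 L) ∈ P ^ 2 ∧ (2 : 𝓞 L) ∉ P ^ 3) ∧ (2 + s ∈ P ∧ 2 + s ∉ P ^ 2) := by
  classical
  have hsL : (s : L) ^ 2 = 2 := by
    have h := congrArg (algebraMap (𝓞 L) L) hs
    rwa [map_pow, map_ofNat] at h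
  haveI := liesOver_span_two h2𝔭
  haveI : P.LiesOver (Ideal.span {(2 : ℤ)}) := Ideal.LiesOver.trans P 𝔭₁ _
  have hP0 : P ≠ ⊥ := Ideal.ne_bot_of_liesOver_of_ne_bot (by simp : Ideal.span {(2 : ℤ)} ≠ ⊥) P
  obtain ⟨he2, -, -⟩ := ramificationIdx_eq_two_of_sq_eq_two h2 hsL 𝔭₁ h2𝔭 hunr P
  -- `e(P | 2ℤ) = e(𝔭₁ | 2ℤ) · e(P | 𝔭₁) = 2`
  have hP2 : P.under (𝓞 K) = 𝔭₁ := (Ideal.over_def P 𝔭₁).symm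
  have htower : P.ramificationIdx ℤ = 2 := by
    have h := Ideal.ramificationIdx_tower (P.under (𝓞 K)) P (R := ℤ)
    rw [hP2, ramificationIdx_int_eq_one_of_two_not_mem_sq 𝔭₁ h2𝔭 hunr, one_mul, he2] at h
    exact h
  have hmap : Ideal.map (algebraMap ℤ (𝓞 L)) (Ideal.span {(2 : ℤ)}) = Ideal.span {(2 : 𝓞 L)} := by
    rw [Ideal.map_span, Set.image_singleton, map_ofNat]
  have hp0 : Ideal.map (algebraMap ℤ (𝓞 L)) (Ideal.span {(2 : ℤ)}) ≠ ⊥ := Ideal.map_ne_bot_of_ne_bot (by simp)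
  have hcount : (normalizedFactors (Ideal.span {(2 : 𝓞 L)})).count P = 2 := by
    rw [← hmap, ← Ideal.IsDedekindDomain.ramificationIdx_eq_normalizedFactors_count (Ideal.span {(2 : ℤ)}) P hp0, htower]
  have h20 : (2 : 𝓞 L) ≠ 0 := two_ne_zero
  have h2P2 : (2 : 𝓞 L) ∈ P ^ 2 := (mem_pow_iff_le_count hP0 h20 2).mpr (by rw [hcount])
  have h2P3 : (2 : 𝓞 L) ∉ P ^ 3 := fun h => by
    have := (mem_pow_iff_le_count hP0 h20 3).mp h
    rw [hcount] at this
    omega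
  -- `s ∈ P ∖ P²`
  have hsP : s ∈ P := by
    have h : s * s ∈ P := by rw [← sq, hs]; exact Ideal.pow_le_self two_ne_zero h2P2
    exact ((inferInstance : P.IsPrime).mem_or_mem h).elim id id
  have hsP2 : s ∉ P ^ 2 := fun h => by
    have h4 : s * s ∈ P ^ 2 * P ^ 2 := Ideal.mul_mem_mul h h
    rw [← pow_add, ← sq, hs] at h4
    exact h2P3 (Ideal.pow_le_pow_right (by norm_num) h4)
  refine ⟨⟨h2P2, h2P3⟩, P.add_mem (Ideal.pow_le_self two_ne_zero h2P2) hsP, fun h => hsP2 ?_⟩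
  have : (2 + s) - 2 ∈ P ^ 2 := (P ^ 2).sub_mem h h2P2
  rwa [add_sub_cancel_left] at this

/-- **`v_P(π₁) = 2` for `π₁ ∈ 𝔭₁ ∖ 𝔭₁²`**: the image of `π₁` in `𝓞_L` lies in `P² ∖ P³` (`𝔭₁𝓞_L ≤ P²` by `e(P | 𝔭₁) = 2`, and
`𝔭₁ = (π₁) + 𝔭₁²`, so `π₁ ∈ P³` would give `𝔭₁𝓞_L ≤ P³`). [cite: NeukirchANT1999, Ch. I §8 Prop. (8.2)] -/
theorem algebraMap_mem_sq_of_mem_of_not_mem_sq (h2 : Module.finrank K L = 2) {s : 𝓞 L} (hs : s ^ 2 = 2)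
    (𝔭₁ : Ideal (𝓞 K)) [𝔭₁.IsPrime] (h2𝔭 : (2 : 𝓞 K) ∈ 𝔭₁) (hunr : (2 : 𝓞 K) ∉ 𝔭₁ ^ 2)
    (P : Ideal (𝓞 L)) [P.IsPrime] [P.LiesOver 𝔭₁] {π₁ : 𝓞 K} (hπ₁ : π₁ ∈ 𝔭₁) (hπ₁' : π₁ ∉ 𝔭₁ ^ 2) :
    algebraMap (𝓞 K) (𝓞 L) π₁ ∈ P ^ 2 ∧ algebraMap (𝓞 K) (𝓞 L) π₁ ∉ P ^ 3 := by
  classical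
  have hsL : (s : L) ^ 2 = 2 := by
    have h := congrArg (algebraMap (𝓞 L) L) hs
    rwa [map_pow, map_ofNat] at h
  have h𝔭0 : 𝔭₁ ≠ ⊥ := fun h => hπ₁' (by rw [h] at hπ₁; rw [(Ideal.mem_bot.mp hπ₁)]; exact zero_mem _)
  have hP0 : P ≠ ⊥ := Ideal.ne_bot_of_liesOver_of_ne_bot h𝔭0 P
  obtain ⟨he2, -, -⟩ := ramificationIdx_eq_two_of_sq_eq_two h2 hsL 𝔭₁ h2𝔭 hunr P
  have hmap0 : Ideal.map (algebraMap (𝓞 K) (𝓞 L)) 𝔭₁ ≠ ⊥ := Ideal.map_ne_bot_of_ne_bot h𝔭0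
  have hcount : (normalizedFactors (Ideal.map (algebraMap (𝓞 K) (𝓞 L)) 𝔭₁)).count P = 2 := by
    rw [← Ideal.IsDedekindDomain.ramificationIdx_eq_normalizedFactors_count 𝔭₁ P hmap0, he2]
  have hmapP2 : Ideal.map (algebraMap (𝓞 K) (𝓞 L)) 𝔭₁ ≤ P ^ 2 :=
    (le_pow_iff_le_count hP0 hmap0 2).mpr (by rw [hcount])
  refine ⟨hmapP2 (Ideal.mem_map_of_mem _ hπ₁), fun h3 => ?_⟩
  -- `𝔭₁ = (π₁) + 𝔭₁²`
  have h𝔭eq : Ideal.span {π₁} ⊔ 𝔭₁ ^ 2 = 𝔭₁ ^ 1 := by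
    refine Ideal.eq_prime_pow_of_succ_lt_of_le h𝔭0 (lt_of_le_of_ne le_sup_right fun h => hπ₁' ?_) ?_
    · rw [h]; exact Ideal.mem_sup_left (Ideal.mem_span_singleton_self π₁)
    · rw [pow_one]; exact sup_le (by rwa [Ideal.span_singleton_le_iff_mem]) (Ideal.pow_le_self two_ne_zero)
  rw [pow_one] at h𝔭eq
  have hle3 : Ideal.map (algebraMap (𝓞 K) (𝓞 L)) 𝔭₁ ≤ P ^ 3 := by
    conv_lhs => rw [← h𝔭eq]
    rw [Ideal.map_sup, Ideal.map_pow, Ideal.map_span, Set.image_singleton]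
    refine sup_le (by rwa [Ideal.span_singleton_le_iff_mem]) ?_
    calc Ideal.map (algebraMap (𝓞 K) (𝓞 L)) 𝔭₁ ^ 2 ≤ (P ^ 2) ^ 2 := Ideal.pow_right_mono hmapP2 2
      _ = P ^ 4 := by rw [← pow_mul]
      _ ≤ P ^ 3 := Ideal.pow_le_pow_right (by norm_num)
  have := (le_pow_iff_le_count hP0 hmap0 3).mp hle3
  rw [hcount] at this
  omega

/-- **THE BASE-FIELD CERTIFICATE ⟹ `v − 1 ∈ P⁴ ∖ P⁵`.**  With `v = A + B s ∈ 𝓞_L` (`A, B ∈ 𝓞_K`) and elements `π₁ ∈ 𝔭₁ ∖ 𝔭₁²`,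
`d, γ₀ ∉ 𝔭₁`, `γ₁` of `𝓞_K` such that `d(A − 1) = π₁²γ₀` and `dB = π₁²γ₁`: then `d(v − 1) = π₁²(γ₀ + γ₁ s)` with `v_P(d) = 0`,
`v_P(π₁) = 2`, `v_P(γ₀ + γ₁ s) = 0`, so `v_P(v − 1) = 4`. Every hypothesis is an identity or an ideal membership in `𝓞_K`
(and is insensitive to the sign of `s`). [cite: Omeara1963, §63A (63:1), §63B (63:10)] [cite: NeukirchANT1999, Ch. I §8 Prop. (8.2)] -/
theorem sub_one_mem_pow_four_of_baseCert (h2 : Module.finrank K L = 2) {s : 𝓞 L} (hs : s ^ 2 = 2)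
    (𝔭₁ : Ideal (𝓞 K)) [𝔭₁.IsPrime] (h2𝔭 : (2 : 𝓞 K) ∈ 𝔭₁) (hunr : (2 : 𝓞 K) ∉ 𝔭₁ ^ 2)
    (P : Ideal (𝓞 L)) [P.IsPrime] [P.LiesOver 𝔭₁] {A B π₁ d γ₀ γ₁ : 𝓞 K} (hπ₁ : π₁ ∈ 𝔭₁) (hπ₁' : π₁ ∉ 𝔭₁ ^ 2)
    (hd : d ∉ 𝔭₁) (hγ₀ : γ₀ ∉ 𝔭₁) (hA : d * (A - 1) = π₁ ^ 2 * γ₀) (hB : d * B = π₁ ^ 2 * γ₁) :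
    algebraMap (𝓞 K) (𝓞 L) A + algebraMap (𝓞 K) (𝓞 L) B * s - 1 ∈ P ^ 4 ∧
      algebraMap (𝓞 K) (𝓞 L) A + algebraMap (𝓞 K) (𝓞 L) B * s - 1 ∉ P ^ 5 := by
  classical
  set f := algebraMap (𝓞 K) (𝓞 L) with hf
  have h𝔭0 : 𝔭₁ ≠ ⊥ := fun h => hπ₁' (by rw [h] at hπ₁; rw [(Ideal.mem_bot.mp hπ₁)]; exact zero_mem _)
  have hP0 : P ≠ ⊥ := Ideal.ne_bot_of_liesOver_of_ne_bot h𝔭0 P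
  have hunder : ∀ x : 𝓞 K, f x ∈ P ↔ x ∈ 𝔭₁ := fun x => by
    rw [hf, ← Ideal.mem_comap, ← Ideal.under_def, ← Ideal.over_def P 𝔭₁]
  obtain ⟨-, hsP, -⟩ := two_mem_sq_and_two_add_mem_of_sq_eq_two h2 hs 𝔭₁ h2𝔭 hunr P
  have hsP : s ∈ P := by
    have h2P : (2 : 𝓞 L) ∈ P := by
      have := (hunder 2).mpr h2𝔭; rwa [map_ofNat] at this
    have : (2 + s) - 2 ∈ P := P.sub_mem hsP h2P
    rwa [add_sub_cancel_left] at this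
  obtain ⟨hπP2, hπP3⟩ := algebraMap_mem_sq_of_mem_of_not_mem_sq h2 hs 𝔭₁ h2𝔭 hunr P hπ₁ hπ₁'
  -- the identity `d (v - 1) = π₁² (γ₀ + γ₁ s)`
  set w := f A + f B * s - 1 with hw
  set γ := f γ₀ + f γ₁ * s with hγ
  have hident : f d * w = f π₁ ^ 2 * γ := by
    have hA' := congrArg f hA
    have hB' := congrArg f hB
    simp only [map_mul, map_sub, map_one, map_pow] at hA' hB'
    rw [hw, hγ]
    linear_combination hA' + s * hB'
  -- valuations: `v_P(d) = 0`, `v_P(γ) = 0`, `v_P(π₁) = 2`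
  have hdP : f d ∉ P := fun h => hd ((hunder d).mp h)
  have hγP : γ ∉ P := fun h => hγ₀ ((hunder γ₀).mp (by
    have : γ - f γ₁ * s ∈ P := P.sub_mem h (P.mul_mem_left _ hsP)
    rwa [hγ, add_sub_cancel_right] at this))
  have hd0 : f d ≠ 0 := fun h => hdP (by rw [h]; exact zero_mem _)
  have hγ0 : γ ≠ 0 := fun h => hγP (by rw [h]; exact zero_mem _)
  have hπ0 : f π₁ ≠ 0 := fun h => hπP3 (by rw [h]; exact zero_mem _)
  have hw0 : w ≠ 0 := fun h => by
    rw [h, mul_zero] at hident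
    exact (mul_ne_zero (pow_ne_zero 2 hπ0) hγ0) hident.symm
  have hcd : (normalizedFactors (Ideal.span {f d})).count P = 0 :=
    count_span_eq_of_mem_of_not_mem (by rw [pow_zero, Ideal.one_eq_top]; exact Submodule.mem_top) (by rwa [pow_one])
  have hcγ : (normalizedFactors (Ideal.span {γ})).count P = 0 :=
    count_span_eq_of_mem_of_not_mem (by rw [pow_zero, Ideal.one_eq_top]; exact Submodule.mem_top) (by rwa [pow_one])
  have hcπ : (normalizedFactors (Ideal.span {f π₁})).count P = 2 := count_span_eq_of_mem_of_not_mem hπP2 hπP3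
  have hcw : (normalizedFactors (Ideal.span {w})).count P = 4 := by
    have h : (normalizedFactors (Ideal.span {f d * w})).count P =
        (normalizedFactors (Ideal.span {f π₁ ^ 2 * γ})).count P := by rw [hident]
    rw [count_span_mul hd0 hw0, count_span_mul (pow_ne_zero 2 hπ0) hγ0, sq, count_span_mul hπ0 hπ0,
      hcd, hcγ, hcπ] at h
    omega
  refine ⟨(mem_pow_iff_le_count hP0 hw0 4).mpr (by rw [hcw]), fun h => ?_⟩
  have := (mem_pow_iff_le_count hP0 hw0 5).mp h
  rw [hcw] at this
  omega

end Quadratic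

end Literature.NumberTheory.NumberFields

end
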